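import Summits.MatrixMultiplication.MatrixMultiplication.Theorems.OutsiderSandwichBorderTableLaws
import HarnessLib

/-!
# The floor-tight ladder: the leaf from floor attainment at every level

Route `OutsiderSandwich` (decomposition cell `decomp-mm`, lens 4 «extremal reduction», gen 29),
support for the aside leaf `BlockOneIsMM` (stmt-MatrixMultiplication-27147).

The border-closed coupled-slice floor (`OutsiderSandwichBorderFloor.border_floor`) says that every
border certificate `⟨B⟩ ⊠ C₁^{⊠(n+1)} ⊵ ⟨m⟩ ⊠ ⟨2,2,2⟩^{⊠(n+1)}` has
`m·4^{n+1} + B·2^n ≤ B·4^{n+1}`.  This file isolates the EXTREMAL certificates: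

1. **The floor's extremal ray** (`floor_eq_iff_pair`): equality in the floor holds exactly for the
   multiples `(B, m) = (k·2^{n+2}, k·(2^{n+2} − 1))` of the saturating pair (`gcd(2^{n+2},
   2^{n+2} − 1) = 1`).  `FloorTight n` := some such certificate with `k ≥ 1` exists; the rung
   `BorderSaturated n` of `OutsiderSandwichBorderTable` is the case `k = 1`, so
   `BorderSaturated n → FloorTight n`, and `FloorTight 0` holds (the cancelling pair).
2. **A weaker ladder with the same reach**: the ratio `B/m = 2^{n+2}/(2^{n+2} − 1)` is scale-free,
   so `FloorTight n → θ⋆ ≤ log₂(2^{n+2}/(2^{n+2} − 1))/(n+1) ≤ 1/(n+1)`, and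
   `(∀ n, FloorTight n) → BlockOneIsMM`: the leaf follows from «the border floor is ATTAINED at
   every level», with `k`-fold amortisation allowed (`blockOneIsMM_of_forall_floorTight`).
3. In table form `FloorTight n ↔ ∃ k ≥ 1, a̲(n+1, k(2^{n+2} − 1)) = k·2^{n+2}`; at level two
   `FloorTight 1 ↔ ∃ k ≥ 1, a̲(2, 7k) = 8k` — the census search may use any multiplicity `k`.
4. `not_border_rate_law`: the restriction-class rate law `3m ≤ 2B` (`OutsiderSandwichLevelLaw`)
   fails for degenerations already at `(1; 4, 3)` (census decomp-mm-census-1 g25, l.1838, named).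

## References
* P. Bürgisser, M. Clausen, M. A. Shokrollahi, *Algebraic Complexity Theory*, Springer 1997,
  (15.19)–(15.26). [BurgisserClausenShokrollahi1997]
* D. Coppersmith, S. Winograd, *Matrix multiplication via arithmetic progressions*,
  J. Symbolic Comput. 9 (1990) 251–280, §7. [CoppersmithWinograd1990]
* V. Strassen, *The asymptotic spectrum of tensors*, J. reine angew. Math. 384 (1988)
  102–152, Thm. 3.8. [Strassen1988]
-/

noncomputable section

open scoped BigOperators

set_option linter.dupNamespace false
set_option autoImplicit false

namespace Summit.MatrixMultiplication.MatrixMultiplication.Theorems.OutsiderSandwichFloorTight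

open Literature.Computability.AlgebraicComplexity
open Summit.MatrixMultiplication.MatrixMultiplication.Theorems.OutsiderSandwichCoupling (coupling₁)
open Summit.MatrixMultiplication.MatrixMultiplication.Theorems.OutsiderSandwichExchangeExponent
  (exchangeExponent exchangeExponent_nonneg blockOneIsMM_iff_exchangeExponent_eq_zero)
open Summit.MatrixMultiplication.MatrixMultiplication.Theorems.OutsiderSandwichCancellingPair
  (amortisedDeg_one_four_three)
open Summit.MatrixMultiplication.MatrixMultiplication.Theorems.OutsiderSandwichBorderTable
  (AmortisedDeg borderAmortisedNumber amortisedDeg_borderAmortisedNumber borderAmortisedNumber_le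
    amortisedDeg_iff_le borderAmortisedNumber_floor BorderSaturated borderSaturated_zero
    saturating_pair_on_floor exchangeExponent_le_of_amortisedDeg
    exchangeExponent_le_inv_of_ratio_le_two)

/-! ## 1. The floor's extremal ray -/

/-- `4^{n+1} = 2^{n+2} · 2^n`. [folklore] -/
theorem four_pow_succ (n : ℕ) : (4 : ℕ) ^ (n + 1) = 2 ^ (n + 2) * 2 ^ n := by
  rw [show (4 : ℕ) = 2 ^ 2 by norm_num, ← pow_mul, ← pow_add]
  congr 1
  ring

/-- `gcd(2^{n+2}, 2^{n+2} − 1) = 1`, as `Coprime (a + 1) a`. [folklore] -/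
theorem coprime_succ_self (a : ℕ) : Nat.Coprime (a + 1) a :=
  (Nat.coprime_self_add_left (m := a) (n := 1)).mpr (Nat.coprime_one_left a)

/-- The floor equation in reduced form: `m·4^{n+1} + B·2^n = B·4^{n+1} ↔ B(2^{n+2} − 1) = m·2^{n+2}`.
[new] -/
theorem floor_eq_iff_reduced (n B m : ℕ) :
    m * 4 ^ (n + 1) + B * 2 ^ n = B * 4 ^ (n + 1) ↔ B * (2 ^ (n + 2) - 1) = m * 2 ^ (n + 2) := by
  obtain ⟨a, ha⟩ : ∃ a : ℕ, 2 ^ (n + 2) = a + 1 :=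
    ⟨2 ^ (n + 2) - 1, by have := Nat.one_le_two_pow (n := n + 2); omega⟩
  have hpos : 0 < 2 ^ n := Nat.two_pow_pos n
  rw [four_pow_succ, ha, Nat.add_sub_cancel]
  constructor
  · intro h
    have h' : (m * (a + 1) + B) * 2 ^ n = (B * (a + 1)) * 2 ^ n := by
      calc (m * (a + 1) + B) * 2 ^ n = m * ((a + 1) * 2 ^ n) + B * 2 ^ n := by ring
        _ = B * ((a + 1) * 2 ^ n) := h
        _ = (B * (a + 1)) * 2 ^ n := by ring
    have h'' := Nat.eq_of_mul_eq_mul_right hpos h'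
    simp only [Nat.mul_succ] at h'' ⊢
    omega
  · intro h
    have h'' : m * (a + 1) + B = B * (a + 1) := by
      simp only [Nat.mul_succ] at h ⊢
      omega
    calc m * ((a + 1) * 2 ^ n) + B * 2 ^ n = (m * (a + 1) + B) * 2 ^ n := by ring
      _ = (B * (a + 1)) * 2 ^ n := by rw [h'']
      _ = B * ((a + 1) * 2 ^ n) := by ring

/-- **The extremal ray**: `B(2^{n+2} − 1) = m·2^{n+2} ↔ (B, m) = k·(2^{n+2}, 2^{n+2} − 1)`.
[new] -/
theorem reduced_iff_pair (n B m : ℕ) :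
    B * (2 ^ (n + 2) - 1) = m * 2 ^ (n + 2) ↔
      ∃ k : ℕ, B = k * 2 ^ (n + 2) ∧ m = k * (2 ^ (n + 2) - 1) := by
  obtain ⟨a, ha⟩ : ∃ a : ℕ, 2 ^ (n + 2) = a + 1 :=
    ⟨2 ^ (n + 2) - 1, by have := Nat.one_le_two_pow (n := n + 2); omega⟩
  rw [ha, Nat.add_sub_cancel]
  constructor
  · intro h
    have hdvd : (a + 1) ∣ B * a := ⟨m, by rw [h, mul_comm]⟩
    obtain ⟨k, hk⟩ := (coprime_succ_self a).dvd_of_dvd_mul_right hdvd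
    refine ⟨k, by rw [hk, mul_comm], ?_⟩
    have : m * (a + 1) = (k * a) * (a + 1) := by rw [← h, hk]; ring
    exact Nat.eq_of_mul_eq_mul_right (Nat.succ_pos a) this
  · rintro ⟨k, rfl, rfl⟩
    ring

/-- **Floor equality ↔ a multiple of the saturating pair.** [new] -/
theorem floor_eq_iff_pair (n B m : ℕ) :
    m * 4 ^ (n + 1) + B * 2 ^ n = B * 4 ^ (n + 1) ↔
      ∃ k : ℕ, B = k * 2 ^ (n + 2) ∧ m = k * (2 ^ (n + 2) - 1) :=
  (floor_eq_iff_reduced n B m).trans (reduced_iff_pair n B m)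

/-! ## 2. The floor-tight ladder -/

/-- **Floor-tight at level `n + 1`**: some multiple of the saturating pair is a border certificate,
`⟨k·2^{n+2}⟩ ⊠ C₁^{⊠(n+1)} ⊵ ⟨k(2^{n+2} − 1)⟩ ⊠ ⟨2,2,2⟩^{⊠(n+1)}` with `k ≥ 1`
(problem-side definition). [new] -/
def FloorTight (n : ℕ) : Prop :=
  ∃ k : ℕ, 0 < k ∧ AmortisedDeg (n + 1) (k * 2 ^ (n + 2)) (k * (2 ^ (n + 2) - 1))

/-- The rung implies floor-tightness (`k = 1`). [new] -/
theorem floorTight_of_borderSaturated {n : ℕ} (h : BorderSaturated n) : FloorTight n :=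
  ⟨1, one_pos, by simpa using h.smul 1⟩

/-- **Level one is floor-tight** (the cancelling pair `⟨4⟩ ⊠ C₁ ⊵ ⟨3⟩ ⊠ ⟨2,2,2⟩`). [new] -/
theorem floorTight_zero : FloorTight 0 :=
  floorTight_of_borderSaturated borderSaturated_zero

/-- Floor-tightness is «the floor is attained by a certificate with `m ≥ 1`». [new] -/
theorem floorTight_iff (n : ℕ) :
    FloorTight n ↔ ∃ B m : ℕ, 0 < m ∧ AmortisedDeg (n + 1) B m ∧
      m * 4 ^ (n + 1) + B * 2 ^ n = B * 4 ^ (n + 1) := by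
  have h1 : 1 ≤ 2 ^ (n + 2) := Nat.one_le_two_pow
  have h4 : 4 ≤ 2 ^ (n + 2) := by
    calc (4 : ℕ) = 2 ^ 2 := by norm_num
      _ ≤ 2 ^ (n + 2) := Nat.pow_le_pow_right (by norm_num) (by omega)
  constructor
  · rintro ⟨k, hk, hd⟩
    refine ⟨_, _, Nat.mul_pos hk (by omega), hd, ?_⟩
    exact (floor_eq_iff_pair n _ _).2 ⟨k, rfl, rfl⟩
  · rintro ⟨B, m, hm, hd, hfl⟩
    obtain ⟨k, rfl, rfl⟩ := (floor_eq_iff_pair n B m).1 hfl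
    exact ⟨k, Nat.pos_of_mul_pos_right hm, hd⟩

/-- **Table form**: `FloorTight n ↔ ∃ k ≥ 1, a̲(n+1, k(2^{n+2} − 1)) = k·2^{n+2}` (the floor
forbids anything smaller). [new] -/
theorem floorTight_iff_borderAmortisedNumber (n : ℕ) :
    FloorTight n ↔ ∃ k : ℕ, 0 < k ∧
      borderAmortisedNumber (n + 1) (k * (2 ^ (n + 2) - 1)) = k * 2 ^ (n + 2) := by
  obtain ⟨a, ha⟩ : ∃ a : ℕ, 2 ^ (n + 2) = a + 1 :=
    ⟨2 ^ (n + 2) - 1, by have := Nat.one_le_two_pow (n := n + 2); omega⟩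
  have hfloor : ∀ k, k * (a + 1) ≤ borderAmortisedNumber (n + 1) (k * a) := by
    intro k
    have hf := borderAmortisedNumber_floor n (k * a)
    rw [four_pow_succ, ha] at hf
    set x := borderAmortisedNumber (n + 1) (k * a)
    have hpos : 0 < 2 ^ n := Nat.two_pow_pos n
    have h' : (k * a * (a + 1) + x) * 2 ^ n ≤ (x * (a + 1)) * 2 ^ n := by
      calc (k * a * (a + 1) + x) * 2 ^ n = k * a * ((a + 1) * 2 ^ n) + x * 2 ^ n := by ring
        _ ≤ x * ((a + 1) * 2 ^ n) := hf
        _ = (x * (a + 1)) * 2 ^ n := by ring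
    have h'' := Nat.le_of_mul_le_mul_right h' hpos
    -- `k a (a+1) + x ≤ x (a+1) = x a + x`, so `k (a+1) a ≤ x a`; cancel `a ≥ 1`
    have ha1 : 0 < a := by have := Nat.one_le_two_pow (n := n + 1); rw [pow_succ] at ha; omega
    have h3 : (k * (a + 1)) * a ≤ x * a := by
      have : k * a * (a + 1) + x ≤ x * a + x := by simpa [Nat.mul_succ] using h''
      nlinarith
    exact Nat.le_of_mul_le_mul_right h3 ha1
  unfold FloorTight
  rw [ha, Nat.add_sub_cancel]
  refine exists_congr fun k => and_congr_right fun hk => ?_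
  rw [amortisedDeg_iff_le]
  constructor
  · exact fun h => le_antisymm h (hfloor k)
  · exact fun h => h.le

/-- At level two: `FloorTight 1 ↔ ∃ k ≥ 1, a̲(2, 7k) = 8k`. [new] -/
theorem floorTight_one_iff :
    FloorTight 1 ↔ ∃ k : ℕ, 0 < k ∧ borderAmortisedNumber 2 (k * 7) = k * 8 := by
  rw [floorTight_iff_borderAmortisedNumber]
  norm_num

/-- At level one the witness is `k = 1`: `a̲(1, 3) = 4`. [new] -/
theorem floorTight_zero_witness : borderAmortisedNumber 1 3 = 4 := by
  obtain ⟨k, hk, h⟩ := (floorTight_iff_borderAmortisedNumber 0).1 floorTight_zero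
  have h3 := Summit.MatrixMultiplication.MatrixMultiplication.Theorems.OutsiderSandwichBorderTable.borderAmortisedNumber_one 3
  norm_num at h3
  exact h3

/-! ## 3. The ladder reaches the leaf -/

/-- **`FloorTight n → θ⋆ ≤ log₂(2^{n+2}/(2^{n+2} − 1))/(n+1)`** (the ratio is scale-free).
[cite: Strassen1988, Thm. 3.8] -/
theorem exchangeExponent_le_of_floorTight {n : ℕ} (h : FloorTight n) :
    exchangeExponent ≤
      Real.logb 2 ((2 : ℝ) ^ (n + 2) / ((2 : ℝ) ^ (n + 2) - 1)) / ((n + 1 : ℕ) : ℝ) := by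
  obtain ⟨k, hk, hd⟩ := h
  have h1 : 1 ≤ 2 ^ (n + 2) := Nat.one_le_two_pow
  have h2 : 2 ≤ 2 ^ (n + 2) := by
    calc (2 : ℕ) = 2 ^ 1 := by norm_num
      _ ≤ 2 ^ (n + 2) := Nat.pow_le_pow_right (by norm_num) (by omega)
  have hm : 0 < k * (2 ^ (n + 2) - 1) := Nat.mul_pos hk (by omega)
  have := exchangeExponent_le_of_amortisedDeg (Nat.succ_pos n) hm hd
  have hk' : (k : ℝ) ≠ 0 := by exact_mod_cast hk.ne'
  have hratio : ((k * 2 ^ (n + 2) : ℕ) : ℝ) / ((k * (2 ^ (n + 2) - 1) : ℕ) : ℝ) =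
      (2 : ℝ) ^ (n + 2) / ((2 : ℝ) ^ (n + 2) - 1) := by
    push_cast [Nat.cast_sub h1]
    rw [mul_div_mul_left _ _ hk']
  rwa [hratio] at this

/-- Coarser: `FloorTight n → θ⋆ ≤ 1/(n+1)`. [cite: Strassen1988, Thm. 3.8] -/
theorem exchangeExponent_le_inv_of_floorTight {n : ℕ} (h : FloorTight n) :
    exchangeExponent ≤ 1 / ((n + 1 : ℕ) : ℝ) := by
  obtain ⟨k, hk, hd⟩ := h
  have h2 : 2 ≤ 2 ^ (n + 2) := by
    calc (2 : ℕ) = 2 ^ 1 := by norm_num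
      _ ≤ 2 ^ (n + 2) := Nat.pow_le_pow_right (by norm_num) (by omega)
  have hm : 0 < k * (2 ^ (n + 2) - 1) := Nat.mul_pos hk (by omega)
  refine exchangeExponent_le_inv_of_ratio_le_two (Nat.succ_pos n) hm hd ?_
  have : 2 ^ (n + 2) ≤ 2 * (2 ^ (n + 2) - 1) := by omega
  calc k * 2 ^ (n + 2) ≤ k * (2 * (2 ^ (n + 2) - 1)) := Nat.mul_le_mul_left k this
    _ = 2 * (k * (2 ^ (n + 2) - 1)) := by ring

/-- **The floor-tight ladder reaches the leaf**: if the border floor is attained at every level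
(with any multiplicity) then `θ⋆ = 0`, i.e. `BlockOneIsMM`. [new] -/
theorem blockOneIsMM_of_forall_floorTight (h : ∀ n : ℕ, FloorTight n) :
    Theses.OutsiderSandwich.BlockOneIsMM := by
  rw [blockOneIsMM_iff_exchangeExponent_eq_zero]
  refine le_antisymm ?_ exchangeExponent_nonneg
  refine le_of_forall_pos_le_add fun δ hδ => ?_
  obtain ⟨n, hn⟩ := exists_nat_one_div_lt hδ
  have := exchangeExponent_le_inv_of_floorTight (h n)
  push_cast at this
  linarith

/-- The two ladders compared: `(∀ n, BorderSaturated n) → (∀ n, FloorTight n) → BlockOneIsMM`.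
[new] -/
theorem forall_floorTight_of_forall_borderSaturated (h : ∀ n : ℕ, BorderSaturated n) :
    ∀ n : ℕ, FloorTight n :=
  fun n => floorTight_of_borderSaturated (h n)

/-! ## 4. The restriction-class rate law fails for degenerations -/

/-- **`¬ (border rate law 3m ≤ 2B)`**: the level law of the restriction class
(`OutsiderSandwichLevelLaw`: `⟨B⟩ ⊠ C₁^{⊠N} ≥ ⟨m⟩ ⊠ ⟨2,2,2⟩^{⊠N} ⟹ 3m ≤ 2B`) fails in the
border class at `(N; B, m) = (1; 4, 3)` (`9 > 8`).  Named after the census's scratch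
`CensusG25B.not_border_rate_law` (decomp-mm-census-1 g25). [new] -/
theorem not_border_rate_law :
    ¬ ∀ N B m : ℕ, AlgDegeneratesTo (kroneckerTensor (unitTensor ℂ B) (kroneckerPow coupling₁ N))
      (kroneckerTensor (unitTensor ℂ m) (kroneckerPow (matMulTensor ℂ 2 2 2) N)) → 3 * m ≤ 2 * B :=
  fun h => absurd (h 1 4 3 amortisedDeg_one_four_three) (by norm_num)

end Summit.MatrixMultiplication.MatrixMultiplication.Theorems.OutsiderSandwichFloorTight
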